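import Summits.BirchSwinnertonDyer.Rank1Residual.X11b.UnrSeriesIdealDescent
import Literature.NumberTheory.EllipticCurves.UnrIntegersUnits
import HarnessLib

/-!
# X11b — DESCENT OF PRINCIPAL-IDEAL **EQUALITY** along `Λ_{R₀} = R₀⟦T⟧ → 𝓞_{ℂ_p}⟦T⟧`: an ideal `I`
# of `R₀⟦T⟧` whose extension to `𝓞_{ℂ_p}⟦T⟧` is `(L)` for some `L ∈ R₀⟦T⟧` IS `(L)` (every prime `p`;
# theorems only; no principality hypothesis on `I`) — the `=`-currency companion of
# `UnrSeriesIdealDescent` (cell `b2b-bsdres`, sub-cell `multr1-p2`, gen 27)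

HONEST FRAMING (cell `b2b-bsdres`, run/shared/lean/b2b/bsd-rank1-residual/, verbatim in every
file): the goal of the cell is to DELETE the COMBINATION-SHAPED residual classes of the
Birch–Swinnerton-Dyer formula for ALL analytic-rank `≤ 1` elliptic curves over `ℚ` — "full BSD
formula for every rank `≤ 1` curve in class `C`" assembled STRICTLY from published theorems — so
that the rank-`≤ 1` remainder becomes exactly the CONSTRUCTION-SHAPED classes, which are TYPED
(missing-input `Prop`s), NOT attempted. This is not "finishing BSD". Sub-cell `multr1-p2` is a
RESEARCH ROUTE on class X11b (`ClassX11b W p := r_an = 1 ∧ p ≠ 2 ∧ mult(p) ∧ irr(p)`); no claim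
beyond the stated class and loci; X11b's label does not change; NOTHING is booked by this file.

THEOREMS ONLY (no definition, no named fact, no `sorry`); pure commutative algebra over the tree's
receptacles `R₀ = unrIntegers p ⊂ 𝓞_{ℂ_p}` (every `p`).

## What this file proves

* §1 `ideal_eq_top_of_map_unrToCpInt_eq_top`: the extension `R₀⟦T⟧ → 𝓞_{ℂ_p}⟦T⟧` REFLECTS the unit
  ideal — if `I·𝓞_{ℂ_p}⟦T⟧ = (1)` then `I = (1)`. Proof (no Weierstrass preparation, no flatness, no
  local-ring API): if `I ≠ (1)` every `g ∈ I` is a non-unit of `R₀⟦T⟧`, so its constant term is a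
  non-unit of `R₀`, i.e. has norm `< 1` (`unrIntegers.isUnit_iff_norm_eq_one`); by span induction
  and the ultrametric inequality every element of `I·𝓞_{ℂ_p}⟦T⟧` then has constant term of norm
  `< 1`, which `1` has not.
* §1 **`ideal_eq_span_singleton_of_map_eq_span`** (EQUALITY DESCENT): `I·𝓞_{ℂ_p}⟦T⟧ = (L)·𝓞_{ℂ_p}⟦T⟧`
  with `L ∈ R₀⟦T⟧` implies `I = (L)` in `R₀⟦T⟧`: `I ⊆ (L)` by gen 26's membership descent
  (`unrSeries_mem_span_singleton_of_map_mem`), so `I = (L)·J` with `J = (I : L)`; extending and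
  cancelling `L ≠ 0` in the domain `𝓞_{ℂ_p}⟦T⟧` gives `J·𝓞_{ℂ_p}⟦T⟧ = (1)`, hence `J = (1)`.
  `ideal_map_unrToCpInt_eq_span_iff`, and for ideals `J ⊆ Λ = ℤ_p⟦T⟧`:
  **`ideal_map_toUnr_eq_span_iff`** (`J·R₀⟦T⟧ = (L) ↔ J·𝓞_{ℂ_p}⟦T⟧ = (L)`).
* (Route R1.) The principal-ideal case needed by route R1 — `Ch_Λ(X_ac)·R₀⟦T⟧ = (L)` iff
  `Ch_Λ(X_ac)·𝓞_{ℂ_p}⟦T⟧ = (L)` — was landed CONCURRENTLY by multr1-p1 GEN 26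
  (`X11b/RouteR1IMCEqDescent.lean`, p286068, via the principality of `Ch_Λ`,
  `charIdeal_isPrincipal_holds`, + gen 26's membership descent); this file is the principal-FREE
  statement for an arbitrary ideal `I ⊆ R₀⟦T⟧` and files no `R1.` corollary (no duplicate).

CONDITIONAL on nothing (pure algebra + the typed predicates as hypotheses); nothing booked; labels
UNCHANGED; no statement about the truth of any main conjecture.

## References

* [Castella2018] F. Castella, Camb. J. Math. 6 (2018), §2.2–§3 (arXiv:1704.06608 pp. 5, 9): the
  receptacles `Λ ⊂ Λ_{R₀}`. * [Castella2018Erratum] Thm. 1.1 (the equality `Ch_Λ(X_ac)Λ_{R₀} = (L_p(f))`,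
  shape only). * [Hsieh2014] p. 7 (arXiv:1112.1580): the receptacle inside `𝓞_{ℂ_p}⟦T⟧`.
-/

noncomputable section

open scoped Classical Topology

open Filter PowerSeries
open Literature.NumberTheory.EllipticCurves
open Summit.BirchSwinnertonDyer.Rank1Residual.X11b.Halves

namespace Summit.BirchSwinnertonDyer.Rank1Residual.X11b

/-! ### §1 Equality descent along `R₀⟦T⟧ → 𝓞_{ℂ_p}⟦T⟧` (every `p`) -/

section Descent

variable {p : ℕ} [hp : Fact p.Prime]

/-- A non-unit of `R₀⟦T⟧` has constant term of norm `< 1` (`R₀` is the valuation ring of a closed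
subfield of `ℂ_p`: units = norm `1`). [folklore] -/
theorem norm_constantCoeff_lt_one_of_not_isUnit {g : UnrSeries p} (hg : ¬ IsUnit g) :
    ‖((PowerSeries.constantCoeff g : unrIntegers p) : ℂ_[p])‖ < 1 := by
  have h1 : ¬ IsUnit (PowerSeries.constantCoeff g) := fun h ↦
    hg (PowerSeries.isUnit_iff_constantCoeff.mpr h)
  rw [unrIntegers.isUnit_iff_norm_eq_one] at h1
  exact lt_of_le_of_ne (norm_coe_unrIntegers_le_one p _) h1

/-- **The extension `R₀⟦T⟧ → 𝓞_{ℂ_p}⟦T⟧` reflects the unit ideal**: `I·𝓞_{ℂ_p}⟦T⟧ = (1) ⟹ I = (1)`.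
Span induction on the constant terms: off the unit ideal they all have norm `< 1`. [folklore] -/
theorem ideal_eq_top_of_map_unrToCpInt_eq_top {I : Ideal (UnrSeries p)}
    (h : I.map (PowerSeries.map (R1.unrToCpInt p)) = ⊤) : I = ⊤ := by
  by_contra hI
  -- every element of the extended ideal has constant term of norm `< 1`
  have key : ∀ y ∈ I.map (PowerSeries.map (R1.unrToCpInt p)),
      ‖((PowerSeries.constantCoeff y : 𝓞_ℂ_[p]) : ℂ_[p])‖ < 1 := by
    intro y hy
    refine Submodule.span_induction (p := fun y _ ↦
      ‖((PowerSeries.constantCoeff y : 𝓞_ℂ_[p]) : ℂ_[p])‖ < 1) ?_ ?_ ?_ ?_ hy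
    · rintro y ⟨g, hg, rfl⟩
      have hgu : ¬ IsUnit g := fun hu ↦ hI (Ideal.eq_top_of_isUnit_mem I hg hu)
      have hc : PowerSeries.constantCoeff (PowerSeries.map (R1.unrToCpInt p) g) =
          R1.unrToCpInt p (PowerSeries.constantCoeff g) := by
        rw [← PowerSeries.coeff_zero_eq_constantCoeff_apply, PowerSeries.coeff_map,
          PowerSeries.coeff_zero_eq_constantCoeff_apply]
      rw [hc, R1.coe_unrToCpInt]
      exact norm_constantCoeff_lt_one_of_not_isUnit hgu
    · simp
    · intro x y _ _ hx hy
      rw [map_add, AddMemClass.coe_add]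
      exact (IsUltrametricDist.norm_add_le_max _ _).trans_lt (max_lt hx hy)
    · intro a x _ hx
      rw [smul_eq_mul, map_mul, MulMemClass.coe_mul, norm_mul]
      have ha : ‖((PowerSeries.constantCoeff a : 𝓞_ℂ_[p]) : ℂ_[p])‖ ≤ 1 :=
        Literature.NumberTheory.LFunctions.Dwork.mem_unitBall.mp (PowerSeries.constantCoeff a).2
      calc ‖((PowerSeries.constantCoeff a : 𝓞_ℂ_[p]) : ℂ_[p])‖ *
            ‖((PowerSeries.constantCoeff x : 𝓞_ℂ_[p]) : ℂ_[p])‖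
          ≤ 1 * ‖((PowerSeries.constantCoeff x : 𝓞_ℂ_[p]) : ℂ_[p])‖ :=
            mul_le_mul_of_nonneg_right ha (norm_nonneg _)
        _ < 1 := by rw [one_mul]; exact hx
  have h1 := key 1 (h ▸ Submodule.mem_top)
  simp at h1

/-- **EQUALITY DESCENT.** For an ideal `I` of `R₀⟦T⟧` and `L ∈ R₀⟦T⟧`: if `I·𝓞_{ℂ_p}⟦T⟧ = (L)` in
`𝓞_{ℂ_p}⟦T⟧` then `I = (L)` in `R₀⟦T⟧`. (`I ⊆ (L)` by the membership descent of gen 26; then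
`I = (L)·(I : L)` and the extension of `(I : L)` is the unit ideal by cancellation of `L ≠ 0` in
the domain `𝓞_{ℂ_p}⟦T⟧`.) [folklore] -/
theorem ideal_eq_span_singleton_of_map_eq_span {I : Ideal (UnrSeries p)} {L : UnrSeries p}
    (h : I.map (PowerSeries.map (R1.unrToCpInt p)) =
      Ideal.span {PowerSeries.map (R1.unrToCpInt p) L}) :
    I = Ideal.span {L} := by
  set φ : UnrSeries p →+* PowerSeries 𝓞_ℂ_[p] := PowerSeries.map (R1.unrToCpInt p) with hφ
  -- `I ⊆ (L)` by membership descent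
  have hle : I ≤ Ideal.span {L} := fun g hg ↦
    unrSeries_mem_span_singleton_of_map_mem (h ▸ Ideal.mem_map_of_mem φ hg)
  rcases eq_or_ne L 0 with rfl | hL0
  · have hbot : Ideal.span ({0} : Set (UnrSeries p)) = ⊥ := Ideal.span_singleton_eq_bot.mpr rfl
    rw [hbot] at hle ⊢
    exact le_bot_iff.mp hle
  -- `I = (L)·J`, `J = (I : L)`
  set J : Ideal (UnrSeries p) := Submodule.colon I {L} with hJ
  have hIJ : I = Ideal.span {L} * J := by
    apply le_antisymm
    · intro g hg
      obtain ⟨a, rfl⟩ := Ideal.mem_span_singleton'.mp (hle hg)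
      have ha : a ∈ J := Submodule.mem_colon_singleton.mpr (by rwa [smul_eq_mul])
      rw [show a * L = L * a from mul_comm a L]
      exact Ideal.mul_mem_mul (Ideal.mem_span_singleton_self L) ha
    · rw [Ideal.mul_le]
      intro r hr s hs
      obtain ⟨b, rfl⟩ := Ideal.mem_span_singleton'.mp hr
      have hsL : s * L ∈ I := by
        have := Submodule.mem_colon_singleton.mp hs
        rwa [smul_eq_mul] at this
      rw [mul_assoc, mul_comm L s]
      exact I.mul_mem_left b hsL
  -- extend and cancel `φ L ≠ 0`
  have hφL : φ L ≠ 0 := fun h0 ↦ hL0 (R1.map_unrToCpInt_injective (p := p) (by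
    rw [map_zero]; exact h0))
  have hmap : Ideal.span {φ L} * J.map φ = Ideal.span {φ L} * ⊤ := by
    have hm : (Ideal.span {L} * J).map φ = Ideal.span {φ L} * J.map φ := by
      rw [Ideal.map_mul, Ideal.map_span, Set.image_singleton]
    rw [← hm, ← hIJ, h, Ideal.mul_top]
  have hJtop : J = ⊤ :=
    ideal_eq_top_of_map_unrToCpInt_eq_top ((Ideal.span_singleton_mul_right_inj hφL).mp hmap)
  rw [hIJ, hJtop, Ideal.mul_top]

/-- **So EQUALITY with a principal ideal does not see the receptacle**: for an ideal `I` of `R₀⟦T⟧`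
and `L ∈ R₀⟦T⟧`, `I·𝓞_{ℂ_p}⟦T⟧ = (L)` iff `I = (L)`. [folklore] -/
theorem ideal_map_unrToCpInt_eq_span_iff (I : Ideal (UnrSeries p)) (L : UnrSeries p) :
    I.map (PowerSeries.map (R1.unrToCpInt p)) =
        Ideal.span {PowerSeries.map (R1.unrToCpInt p) L} ↔
      I = Ideal.span {L} := by
  refine ⟨ideal_eq_span_singleton_of_map_eq_span, fun h ↦ ?_⟩
  rw [h, Ideal.map_span, Set.image_singleton]

/-- **The version for ideals of `Λ = ℤ_p⟦T⟧`** (the shape of the main-conjecture conjunct): for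
`J ⊆ Λ` and `L ∈ R₀⟦T⟧`, `J·R₀⟦T⟧ = (L)` in `R₀⟦T⟧` iff `J·𝓞_{ℂ_p}⟦T⟧ = (L)` in `𝓞_{ℂ_p}⟦T⟧`.
[cite: Castella2018, §2.2 and §3 (arXiv:1704.06608 pp. 5, 9)] -/
theorem ideal_map_toUnr_eq_span_iff (J : Ideal (IwasawaAlgebra p)) (L : UnrSeries p) :
    J.map (PowerSeries.map (toUnr p)) = Ideal.span {L} ↔
      J.map (PowerSeries.map (R1.toCpInt p)) =
        Ideal.span {PowerSeries.map (R1.unrToCpInt p) L} := by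
  rw [R1.map_toCpInt_eq_comp, ← Ideal.map_map]
  exact (ideal_map_unrToCpInt_eq_span_iff _ L).symm

end Descent

end Summit.BirchSwinnertonDyer.Rank1Residual.X11b

end
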